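import Summits.MatrixMultiplication.MatrixMultiplication.Theorems.FarEdgeDescentSpecialFloor
import Literature.Computability.AlgebraicComplexity.QuantumFunctionalsBounds
import Literature.Computability.AlgebraicComplexity.QuantumFunctionalPointHolds
import HarnessLib

/-!
# The quantum functionals are identically `4` on the BCZ line

Route `FarEdgeDescent` (cell `decomp-mm`, lens 2 «structural dichotomy (special vs generic)»,
gen 37), Kernel XII-b; support for the aside `SubLogRate` (stmt-MatrixMultiplication-25371).
Typed by the cell critic (decomp-mm-crit-1 g12, probe `W2_quantum_probe`, remark r3 on Kernel XI)
and landed here next to `FarEdgeDescentGaugeFlat` / `FarEdgeDescentSpecialFloor`.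

The Christandl–Vrana–Zuiddam upper bound (Thm 3.19(5), tree fact
`ChristandlVranaZuiddam2023_bounds_holds`) caps every quantum functional `F^θ` by
`4^{θ₀} 4^{θ₁} 4^{θ₂} = 4` on the `4 × 4 × 4` format; the Kernel XI floor
(`four_le_spectralPoint_fam`, `four_le_spectralPoint_of_corank_le_one`) and universality of `F^θ`
(Cor. 3.31, `isUniversalSpectralPoint_quantumFunctionalPoint`) give the other inequality:

* `quantumFunctionalPoint_fam`: **`F^θ(𝔖(q)) = 4` for every `θ` and every `q ∈ ℂ`** — the whole
  known part of `Δ(ℂ)` (gauge points, Kernel XI-d, and quantum functionals) is CONSTANT on the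
  closed BCZ line: it cannot see the special/generic dichotomy at all;
* `quantumFunctionalPoint_corank_le_one`: `F^θ ≡ 4` on every corank `≤ 1` member of the support
  class of `⟨2,2,2⟩`;
* `exists_nonQuantum_on_line_of_not_summit`: **if `ω > 2` then some universal spectral point over
  `ℂ` exceeds `4` somewhere on the line and is neither a gauge point nor any `F^θ`** — a universal
  point outside the only known family;
* `summit_of_line_spectrum_quantum`: contrapositive packaging — if every universal point agrees
  with some `F^θ` along the line, then `_root_.MatrixMultiplication`.

References: M. Christandl, P. Vrana, J. Zuiddam, *Universal points in the asymptotic spectrum of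
tensors*, J. AMS 36 (2023), Thm 3.19(5), Cor. 3.31 [ChristandlVranaZuiddam2023]; M. Bläser,
M. Christandl, J. Zuiddam, arXiv:1705.09652, §2 [BlaserChristandlZuiddam2017]; V. Strassen,
J. reine angew. Math. 384 (1988) [Strassen1988].
-/

noncomputable section

open scoped BigOperators

set_option linter.dupNamespace false

namespace Summit.MatrixMultiplication.MatrixMultiplication.Theorems.FarEdgeDescentQuantumFlat

open Literature.Computability.AlgebraicComplexity
open Summit.MatrixMultiplication.MatrixMultiplication.Theorems.FarEdgeDescentSignTwist
open Summit.MatrixMultiplication.MatrixMultiplication.Theorems.FarEdgeDescentSignTwistDet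
open Summit.MatrixMultiplication.MatrixMultiplication.Theorems.FarEdgeDescentWeightFamily
open Summit.MatrixMultiplication.MatrixMultiplication.Theorems.FarEdgeDescentGenericDomination
open Summit.MatrixMultiplication.MatrixMultiplication.Theorems.FarEdgeDescentRankOneCoupling
open Summit.MatrixMultiplication.MatrixMultiplication.Theorems.FarEdgeDescentZeroWeightMember
open Summit.MatrixMultiplication.MatrixMultiplication.Theorems.FarEdgeDescentSupportClass
open Summit.MatrixMultiplication.MatrixMultiplication.Theorems.FarEdgeDescentSpecialClass
open Summit.MatrixMultiplication.MatrixMultiplication.Theorems.FarEdgeDescentSpecialValue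
open Summit.MatrixMultiplication.MatrixMultiplication.Theorems.FarEdgeDescentSpecialLevel
open Summit.MatrixMultiplication.MatrixMultiplication.Theorems.FarEdgeDescentGaugeFlat
open Summit.MatrixMultiplication.MatrixMultiplication.Theorems.FarEdgeDescentSupportLattice
open Summit.MatrixMultiplication.MatrixMultiplication.Theorems.FarEdgeDescentSpecialFloor

/-- **CVZ Thm 3.19(5) on the `4 × 4 × 4` format: `F^θ(T) ≤ 4^{θ₀} 4^{θ₁} 4^{θ₂} = 4`.**
[cite: ChristandlVranaZuiddam2023, Thm 3.19(5)] -/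
theorem quantumFunctionalPoint_le_four {θ : Fin 3 → ℝ} (hθ : θ ∈ stdSimplex ℝ (Fin 3))
    (T : Leaf2 → (Fin 2 × Fin 2) → Leaf2 → ℂ) : quantumFunctionalPoint θ T ≤ 4 := by
  have h := (ChristandlVranaZuiddam2023_bounds_holds θ hθ T).2
  rw [quantumFunctionalPoint_apply]
  have c1 : Fintype.card Leaf2 = 4 := rfl
  have c2 : Fintype.card (Fin 2 × Fin 2) = 4 := rfl
  rw [c1, c2] at h
  have hm : (min ((4 : ℕ) : ℝ) (((4 : ℕ) : ℝ) * ((4 : ℕ) : ℝ))) = 4 := by norm_num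
  rw [hm] at h
  have hsum : θ 0 + θ 1 + θ 2 = 1 := by simpa [Fin.sum_univ_three] using hθ.2
  have h4 : (4 : ℝ) ^ θ 0 * (4 : ℝ) ^ θ 1 * (4 : ℝ) ^ θ 2 = 4 := by
    rw [← Real.rpow_add (by norm_num : (0 : ℝ) < 4), ← Real.rpow_add (by norm_num : (0 : ℝ) < 4),
      hsum, Real.rpow_one]
  linarith [h4]

/-- **`F^θ ≡ 4` on the whole BCZ line** (`𝔖(0)`, `𝔖(1) ≅ ⟨2,2,2⟩` and the generic stratum
alike): floor `four_le_spectralPoint_fam` (Kernel XI-f) + the CVZ cap.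
[cite: ChristandlVranaZuiddam2023, Thm 3.19(5), Cor 3.31] [cite: BlaserChristandlZuiddam2017, §2] -/
theorem quantumFunctionalPoint_fam {θ : Fin 3 → ℝ} (hθ : θ ∈ stdSimplex ℝ (Fin 3)) (q : ℂ) :
    quantumFunctionalPoint θ (fam ℂ q) = 4 :=
  le_antisymm (quantumFunctionalPoint_le_four hθ _)
    (four_le_spectralPoint_fam (isUniversalSpectralPoint_quantumFunctionalPoint hθ) q)

/-- **The line is `F^θ`-flat**: `F^θ(𝔖(q)) = F^θ(⟨2,2,2⟩)` for all `q` (via `𝔖(1)`).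
[cite: ChristandlVranaZuiddam2023, Thm 3.19(5)] -/
theorem quantumFunctionalPoint_fam_eq_fam_one {θ : Fin 3 → ℝ} (hθ : θ ∈ stdSimplex ℝ (Fin 3))
    (q : ℂ) : quantumFunctionalPoint θ (fam ℂ q) = quantumFunctionalPoint θ (fam ℂ 1) := by
  rw [quantumFunctionalPoint_fam hθ, quantumFunctionalPoint_fam hθ]

/-- **`F^θ ≡ 4` on every corank `≤ 1` member of the support class of `⟨2,2,2⟩`.**
[cite: ChristandlVranaZuiddam2023, Thm 3.19(5), Cor 3.31] -/
theorem quantumFunctionalPoint_corank_le_one {θ : Fin 3 → ℝ} (hθ : θ ∈ stdSimplex ℝ (Fin 3))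
    {T : Leaf2 → (Fin 2 × Fin 2) → Leaf2 → ℂ} (hT : ∀ a x c, fam ℂ 1 a x c = 0 → T a x c = 0)
    (h : (zeroEntries T).card ≤ 1) : quantumFunctionalPoint θ T = 4 :=
  le_antisymm (quantumFunctionalPoint_le_four hθ T)
    (four_le_spectralPoint_of_corank_le_one (isUniversalSpectralPoint_quantumFunctionalPoint hθ)
      hT h)

/-- **Every member of the support class is `F^θ`-capped by `4`**, in particular the special
class. [cite: ChristandlVranaZuiddam2023, Thm 3.19(5)] -/
theorem quantumFunctionalPoint_supportClass_le_four {θ : Fin 3 → ℝ}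
    (hθ : θ ∈ stdSimplex ℝ (Fin 3)) {T : Leaf2 → (Fin 2 × Fin 2) → Leaf2 → ℂ}
    (_hT : ∀ a x c, fam ℂ 1 a x c = 0 → T a x c = 0) : quantumFunctionalPoint θ T ≤ 4 :=
  quantumFunctionalPoint_le_four hθ T

/-- **The Kernel XI-d witness sharpened**: if the summit fails, some universal spectral point over
`ℂ` exceeds `4` on the line and is NEITHER a gauge point NOR a CVZ quantum functional.
[cite: ChristandlVranaZuiddam2023, Cor 3.31] [cite: Strassen1988] -/
theorem exists_nonQuantum_on_line_of_not_summit (hS : ¬ _root_.MatrixMultiplication) :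
    ∃ (q₀ : ℂ) (Φ : SpectralMap ℂ), IsUniversalSpectralPoint ℂ Φ ∧ 4 < Φ (fam ℂ q₀) ∧
      (∀ θ : Fin 3 → ℝ, θ ∈ stdSimplex ℝ (Fin 3) → Φ ≠ quantumFunctionalPoint θ) ∧
        Φ ≠ gaugePoint₁ ℂ ∧ Φ ≠ gaugePoint₂ ℂ ∧ Φ ≠ gaugePoint₃ ℂ := by
  obtain ⟨q₀, Φ, hΦ, -, -, h4, hg₁, hg₂, hg₃⟩ := exists_nonGauge_on_line_of_not_summit hS
  refine ⟨q₀, Φ, hΦ, h4, fun θ hθ heq => ?_, hg₁, hg₂, hg₃⟩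
  rw [heq, quantumFunctionalPoint_fam hθ q₀] at h4
  exact lt_irrefl _ h4

/-- **Contrapositive packaging**: if every universal spectral point over `ℂ` agrees with some
`F^θ` along the BCZ line, then `ω = 2`. [cite: ChristandlVranaZuiddam2023, Cor 3.31]
[cite: Strassen1988] -/
theorem summit_of_line_spectrum_quantum
    (h : ∀ Φ : SpectralMap ℂ, IsUniversalSpectralPoint ℂ Φ → ∃ θ : Fin 3 → ℝ,
      θ ∈ stdSimplex ℝ (Fin 3) ∧ ∀ q : ℂ, Φ (fam ℂ q) = quantumFunctionalPoint θ (fam ℂ q)) :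
    _root_.MatrixMultiplication := by
  by_contra hS
  obtain ⟨q₀, Φ, hΦ, h4, -, -⟩ := exists_nonQuantum_on_line_of_not_summit hS
  obtain ⟨θ, hθ, hq⟩ := h Φ hΦ
  rw [hq q₀, quantumFunctionalPoint_fam hθ q₀] at h4
  exact lt_irrefl _ h4

/-- **Equivalently: `ω = 2` iff every universal point is `≤ 4` along the line** — and the
`F^θ` already are; the summit is exactly the absence of an exceptional universal point on the
line. [cite: ChristandlVranaZuiddam2023, Cor 3.31] [cite: Strassen1988] -/
theorem summit_of_line_le_four
    (h : ∀ Φ : SpectralMap ℂ, IsUniversalSpectralPoint ℂ Φ → ∀ q : ℂ, Φ (fam ℂ q) ≤ 4) :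
    _root_.MatrixMultiplication := by
  by_contra hS
  obtain ⟨q₀, Φ, hΦ, h4, -, -⟩ := exists_nonQuantum_on_line_of_not_summit hS
  exact absurd (h Φ hΦ q₀) (not_le.mpr h4)

end Summit.MatrixMultiplication.MatrixMultiplication.Theorems.FarEdgeDescentQuantumFlat

end
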